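import Summits.HodgeConjecture.HodgeConjecture.Theorems.WeilTypeLadderTargetTransfer
import Literature.AlgebraicGeometry.HodgeTheory.FermatHodgeConjectureProducts
import Mathlib.RingTheory.Polynomial.Cyclotomic.Expand
import Mathlib.RingTheory.Polynomial.Cyclotomic.Roots
import Mathlib.Analysis.SpecialFunctions.Complex.Circle
import Mathlib.NumberTheory.Zsqrtd.GaussianInt
import Mathlib.Tactic.ComputeDegree
import HarnessLib

/-!
# WeilTypeLadder · R3 (`WeilClassesCMField`) for the BIQUADRATIC CM subfield `K′ = ℚ(√-3, √5) = ℚ(ζ₁₅)^{⟨4⟩}` of `ℚ(ζ₁₅)`: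
# generator `θ = (ζ + ζ⁴) − (ζ⁻¹ + ζ⁻⁴)` with minimal polynomial `T⁴ + 9T² + 9` — IRREDUCIBILITY BY FACTOR EXCLUSION (`V₄`: no
# Eisenstein prime), purely imaginary roots (`Q = −T`), `P(φ) = 0 ⇐ Φ₁₅(s) = 0` by reduction; the transfer over `Xʰ₁₅ ⊗ Xʰ₁₅`

b2b cell `hweil` (packet `run/shared/lean/b2b/hodge-weil/`, report `b2b-hweil-pv3-g43/CM-SUBFIELD-TRANSFER.md` §3.3 row
`(15, ℚ(√-3,√5))` and ADDENDUM B). `E = ℚ(ζ₁₅)`, `H′ = {1, 4}` (`4 ≡ 1 mod 3`, `≡ −1 mod 5`), `K′ = E^{H′} = ℚ(ζ₃, √5) = ℚ(√-3, √5)`,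
`s = 2`. Generator: with the period `η = ζ + ζ⁴` of `H′`, `θ := η − η̄ = ζ + ζ⁴ − ζ¹⁴ − ζ¹¹` (`θ̄ = −θ`); numerically the four conjugates
`±θ₁, ±θ₂` have characteristic polynomial **`P = T⁴ + 9T² + 9`** (`θ₁² + θ₂² = −9`, `θ₁²θ₂² = 9`); on `B` with `Φ₁₅(s) = 0`:
**`φ := s + s⁴ − s¹¹ − s¹⁴`**, and `P(φ) = 0` by REDUCTION modulo `Φ₁₅ = T⁸ − T⁷ + T⁵ − T⁴ + T³ − T + 1` (`φ ≡ r₁`, `r₁² ≡ r₂`, `r₂² ≡ r₄`,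
`r₄ + 9r₂ + 9 = 0`; each identity of degree `≤ 14`, `ring`).

What is PROVED here (kernel): (§1) `P` monic of degree `4`; **irreducible over `ℚ`** by factor exclusion (degree-`1` factor: rational root
of a positive polynomial; degree-`2` factor: `a + c = 0`, `ad + bc = 0`, `b + d + ac = 9`, `bd = 9`, whence `a = 0`, `(b − d)² = 45 = 5·3²`
(`√5 ∉ ℚ`) or `d = b`, `b² = 9`, `a² = 2b − 9 < 0`); `ρ² = (−9 ± √45)/2 ∈ ℝ`, `ρ̄ ≠ ρ`, `ρ̄ = −ρ` (`Q = −T`); `Φ₁₅` explicit (`expand 3 Φ₅ =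
Φ₁₅·Φ₅`, cancellation in `ℤ[T]`); the reductions; `P(φ) = 0`. (§2) the R3 body over `Xʰ₁₅ ⊗ Xʰ₁₅` from the two refereed named facts;
from the rung (HONEST SPECIALISATION at `(B, φ, T⁴ + 9T² + 9, 4, h)`); ON-PATH.

What is NOT in the kernel: the datum (PROPOSITION CYC′) and `K′`-Weil-ness (THEOREM W′). Census (report §3.3): at `N = 4` the unique
`K′`-Weil NON-`E`-Weil family is `(1,9,9,11)` (MOVING; `D = (1,0,1,0,2,1,2,1)`); `N = 5`: 15 two-parameter families of 12-folds.
With this file EVERY proper CM subfield of degree `≥ 4` of `ℚ(ζ_m)`, `m ≤ 20`, has a named, fully discharged R3 instance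
(primes `m > 20` have further ones, e.g. `ℚ(ζ₃₁)^{C₃}` of degree `10` — not typed).

HONEST LABEL: as the companions (sub-families; 0 unconditional rungs; conditional on [Shioda 1979 Thm. 2] + [Fulton 1998 Cor. 19.2 (b)]
and on the datum; Markman-free; `weilClassesField` identification flag). No `sorry`, no new definition, no new named fact.
-/

noncomputable section

-- every declaration of this problem lives in `Summit.HodgeConjecture.HodgeConjecture.…` (summit = sub-problem)
set_option linter.dupNamespace false

open CategoryTheory MonoidalCategory Polynomial
open Literature.AlgebraicGeometry Literature.AlgebraicGeometry.Motives
open Literature.AlgebraicGeometry.HodgeTheory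
open Literature.AlgebraicTopology.SingularHomology

namespace Summit.HodgeConjecture.HodgeConjecture.WeilTypeLadder

/-! ### §1 The biquadratic minimal polynomial `T⁴ + 9T² + 9` (Galois group `V₄`: no Eisenstein prime) and `Φ_15` -/

section Quartic

/-- `T⁴ + 9T² + 9 ∈ ℤ[T]` is monic. [folklore] -/
theorem quarticFifteenBiq_monic : (X ^ 4 + 9 * X ^ 2 + 9 : Polynomial ℤ).Monic := by
  monicity!

/-- `T⁴ + 9T² + 9` has degree `4`. [folklore] -/
theorem quarticFifteenBiq_natDegree : (X ^ 4 + 9 * X ^ 2 + 9 : Polynomial ℤ).natDegree = 4 := by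
  compute_degree!

/-- No rational numbers `b, d` with `b + d = 9`, `b·d = 9` (else `((b - d) / 3)` would be a rational square root of `5`):
the `a = 0` branch of the factor exclusion below. [folklore] -/
theorem quarticFifteenBiq_no_rational_splitting (b d : ℚ) (h1 : b + d = 9) (h2 : b * d = 9) : False := by
  have hsq : (((b - d) / 3) : ℚ) ^ 2 = 5 := by linear_combination ((b + d + 9) * h1 - 4 * h2) / 9
  have hirr : Irrational (Real.sqrt 5) := Nat.Prime.irrational_sqrt (by norm_num)
  have h5 : Real.sqrt 5 = |((((b - d) / 3) : ℚ) : ℝ)| := by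
    rw [← Real.sqrt_sq_eq_abs]; congr 1; exact_mod_cast hsq.symm
  exact hirr.ne_rat |((b - d) / 3)| (by rw [h5]; push_cast; rfl)

/-- **`T⁴ + 9T² + 9` is irreducible over `ℚ`** — by EXCLUSION OF FACTORS (its Galois group is `V₄`, so it is reducible modulo every prime
and no Eisenstein prime exists): a monic rational factor of degree `1` is a rational root (impossible: the polynomial is positive on
`ℝ`); a monic rational factor `T² + aT + b` with cofactor `T² + cT + d` forces (comparing values at `0, ±1, ±2`) `a + c = 0`,
`ad + bc = 0`, `b + d + ac = 9`, `bd = 9`, hence `a = 0` and `(b − d)² = 45 = 5·3²` (but `√5` is irrational) or `d = b`,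
`b² = 9`, `a² = 2b − 9 < 0`. [folklore] -/
theorem quarticFifteenBiq_irreducible_rat : Irreducible (X ^ 4 + 9 * X ^ 2 + 9 : Polynomial ℚ) := by
  have hm : (X ^ 4 + 9 * X ^ 2 + 9 : Polynomial ℚ).Monic := by monicity!
  have hdeg : (X ^ 4 + 9 * X ^ 2 + 9 : Polynomial ℚ).natDegree = 4 := by compute_degree!
  have hne1 : (X ^ 4 + 9 * X ^ 2 + 9 : Polynomial ℚ) ≠ 1 := by
    intro h; have := congrArg Polynomial.natDegree h; rw [hdeg] at this; simp at this
  rw [hm.irreducible_iff_lt_natDegree_lt hne1]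
  intro q hq hqdeg
  rw [hdeg, Finset.mem_Ioc] at hqdeg
  rintro ⟨r, hr⟩
  have hrm : r.Monic := Polynomial.Monic.of_mul_monic_left hq (hr ▸ hm)
  have hsum : q.natDegree + r.natDegree = 4 := by
    rw [← Polynomial.Monic.natDegree_mul hq hrm, ← hr, hdeg]
  have hev : ∀ x : ℚ, x ^ 4 + 9 * x ^ 2 + 9 = Polynomial.eval x q * Polynomial.eval x r := by
    intro x
    have := congrArg (Polynomial.eval x) hr
    simpa [Polynomial.eval_mul] using this
  rcases Nat.lt_or_ge q.natDegree 2 with h1 | h2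
  · -- degree 1: a rational root
    have hq1 : q.natDegree = 1 := by omega
    set a0 := q.coeff 0 with ha0
    have hqf : q = X + C a0 := hq.eq_X_add_C hq1
    have h0 := hev (-a0)
    rw [hqf, Polynomial.eval_add, Polynomial.eval_X, Polynomial.eval_C] at h0
    nlinarith [sq_nonneg a0, sq_nonneg (a0 ^ 2)]
  · -- degree 2: a rational quadratic factor
    have hq2 : q.natDegree = 2 := by omega
    have hr2 : r.natDegree = 2 := by omega
    set a := q.coeff 1 with ha
    set b := q.coeff 0 with hb
    set c := r.coeff 1 with hc
    set d := r.coeff 0 with hd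
    have hqf : q = X ^ 2 + C a * X + C b := by
      have := hq.as_sum; rw [hq2] at this; rw [this]
      simp only [Finset.sum_range_succ, Finset.sum_range_zero, zero_add, pow_zero, mul_one, pow_one]; ring
    have hrf : r = X ^ 2 + C c * X + C d := by
      have := hrm.as_sum; rw [hr2] at this; rw [this]
      simp only [Finset.sum_range_succ, Finset.sum_range_zero, zero_add, pow_zero, mul_one, pow_one]; ring
    have hev' : ∀ x : ℚ, x ^ 4 + 9 * x ^ 2 + 9 = (x ^ 2 + a * x + b) * (x ^ 2 + c * x + d) := by
      intro x; have := hev x; rw [hqf, hrf] at this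
      simpa [Polynomial.eval_add, Polynomial.eval_mul, Polynomial.eval_pow, Polynomial.eval_X, Polynomial.eval_C] using this
    have e0 := hev' 0
    have e1 := hev' 1
    have em1 := hev' (-1)
    have e2 := hev' 2
    have em2 := hev' (-2)
    have hA3 : a + c = 0 := by linear_combination (-(e2 - em2) + 2 * (e1 - em1)) / 12
    have hA1 : a * d + b * c = 0 := by
      linear_combination (-(e1 - em1)) / 2 - (-(e2 - em2) + 2 * (e1 - em1)) / 12
    have hA0 : b * d = 9 := by linear_combination -e0
    have hA2 : b + d + a * c = 9 := by linear_combination (-(e1 + em1)) / 2 + e0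
    have hc' : c = -a := by linear_combination hA3
    rw [hc'] at hA1 hA2
    have had : a * (d - b) = 0 := by linear_combination hA1
    rcases mul_eq_zero.1 had with h0 | hdb
    · -- a = 0: (b - d)² = 45 = 5·3²
      rw [h0] at hA2
      have hbd : b + d = 9 := by linear_combination hA2
      exact quarticFifteenBiq_no_rational_splitting b d hbd hA0
    · -- d = b: b² = 9 and a² = 2b − 9 < 0
      have hdb' : d = b := by linarith
      rw [hdb'] at hA0 hA2
      nlinarith [sq_nonneg a, sq_nonneg (b - 3), sq_nonneg (b + 3)]

/-- Irreducibility over `ℚ` in the rung's form (`P ∈ ℤ[T]` mapped to `ℚ[T]`). [folklore] -/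
theorem quarticFifteenBiq_irreducible :
    Irreducible ((X ^ 4 + 9 * X ^ 2 + 9 : Polynomial ℤ).map (Int.castRingHom ℚ)) := by
  have h : ((X ^ 4 + 9 * X ^ 2 + 9 : Polynomial ℤ).map (Int.castRingHom ℚ)) = (X ^ 4 + 9 * X ^ 2 + 9 : Polynomial ℚ) := by
    simp [Polynomial.map_add, Polynomial.map_mul, Polynomial.map_pow, Polynomial.map_X, Polynomial.map_ofNat]
  rw [h]; exact quarticFifteenBiq_irreducible_rat

/-- Evaluation of `T⁴ + 9T² + 9` in any ring. -/
theorem eval₂_quarticFifteenBiq {R : Type*} [Ring R] (x : R) :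
    Polynomial.eval₂ (Int.castRingHom R) x (X ^ 4 + 9 * X ^ 2 + 9 : Polynomial ℤ) = x ^ 4 + 9 * x ^ 2 + 9 := by
  rw [← algebraMap_int_eq, ← Polynomial.aeval_def]
  simp only [map_add, map_mul, map_pow, Polynomial.aeval_X, map_ofNat]

/-- A complex root `ρ` has `(2ρ² + 9)² = 45`, so `ρ²` is REAL and `ρ̄² = ρ²`. [folklore] -/
theorem conj_sq_eq_sq_of_quarticFifteenBiq {ρ : ℂ} (hρ : ρ ^ 4 + 9 * ρ ^ 2 + 9 = 0) :
    starRingEnd ℂ (ρ ^ 2) = ρ ^ 2 := by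
  have h2 : (2 * ρ ^ 2 + 9) ^ 2 = ((Real.sqrt 45 : ℝ) : ℂ) ^ 2 := by
    have hs : ((Real.sqrt 45 : ℝ) : ℂ) ^ 2 = 45 := by
      rw [← Complex.ofReal_pow, Real.sq_sqrt (by norm_num : (0 : ℝ) ≤ 45)]; norm_num
    rw [hs]; linear_combination 4 * hρ
  rcases sq_eq_sq_iff_eq_or_eq_neg.1 h2 with h | h
  · have : ρ ^ 2 = (((Real.sqrt 45 - 9) / 2 : ℝ) : ℂ) := by push_cast; linear_combination h / 2
    rw [this, Complex.conj_ofReal]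
  · have : ρ ^ 2 = (((-Real.sqrt 45 - 9) / 2 : ℝ) : ℂ) := by push_cast; linear_combination h / 2
    rw [this, Complex.conj_ofReal]

/-- The complex roots are NON-REAL: the rung's "no real root". [folklore] -/
theorem conj_ne_self_of_quarticFifteenBiq {ρ : ℂ}
    (hρ : Polynomial.eval₂ (Int.castRingHom ℂ) ρ (X ^ 4 + 9 * X ^ 2 + 9 : Polynomial ℤ) = 0) :
    starRingEnd ℂ ρ ≠ ρ := by
  rw [eval₂_quarticFifteenBiq] at hρ
  intro hc
  have hre : ((ρ.re : ℝ) : ℂ) = ρ := Complex.conj_eq_iff_re.mp hc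
  have hr : ((ρ.re ^ 4 + 9 * ρ.re ^ 2 + 9 : ℝ) : ℂ) = 0 := by push_cast; rw [hre]; exact hρ
  have hr' : ρ.re ^ 4 + 9 * ρ.re ^ 2 + 9 = 0 := by exact_mod_cast hr
  nlinarith [sq_nonneg ρ.re, sq_nonneg (ρ.re ^ 2)]

/-- `Q = −T` carries every complex root to its conjugate: the rung's "CM involution is a polynomial". [folklore] -/
theorem exists_conjPolynomial_quarticFifteenBiq :
    ∃ Q : Polynomial ℚ, ∀ ρ : ℂ, Polynomial.eval₂ (Int.castRingHom ℂ) ρ (X ^ 4 + 9 * X ^ 2 + 9 : Polynomial ℤ) = 0 →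
      Polynomial.eval₂ (algebraMap ℚ ℂ) ρ Q = starRingEnd ℂ ρ := by
  refine ⟨-Polynomial.X, fun ρ hρ => ?_⟩
  have hne := conj_ne_self_of_quarticFifteenBiq hρ
  rw [eval₂_quarticFifteenBiq] at hρ
  rw [Polynomial.eval₂_neg, Polynomial.eval₂_X]
  have hsq : (starRingEnd ℂ ρ) ^ 2 = ρ ^ 2 := by
    rw [← map_pow]; exact conj_sq_eq_sq_of_quarticFifteenBiq hρ
  rcases sq_eq_sq_iff_eq_or_eq_neg.1 hsq with h | h
  · exact absurd h hne
  · exact h.symm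

/-- `Φ₁₅ = T⁸ − T⁷ + T⁵ − T⁴ + T³ − T + 1` in `ℤ[T]` (`expand 3 Φ₅ = Φ₁₅·Φ₅`, cancellation of `Φ₅ ≠ 0`). [folklore] -/
theorem cyclotomic_fifteen_eq : Polynomial.cyclotomic 15 ℤ = X ^ 8 - X ^ 7 + X ^ 5 - X ^ 4 + X ^ 3 - X + 1 := by
  have h5 : Polynomial.cyclotomic 5 ℤ = 1 + X + X ^ 2 + X ^ 3 + X ^ 4 := by
    haveI : Fact (Nat.Prime 5) := ⟨by norm_num⟩
    rw [Polynomial.cyclotomic_prime]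
    simp only [Finset.sum_range_succ, Finset.sum_range_zero, zero_add, pow_zero, pow_one]
  have hx : Polynomial.expand ℤ 3 (Polynomial.cyclotomic 5 ℤ) = Polynomial.cyclotomic 15 ℤ * Polynomial.cyclotomic 5 ℤ := by
    have := Polynomial.cyclotomic_expand_eq_cyclotomic_mul Nat.prime_three (by norm_num : ¬ 3 ∣ 5) ℤ
    simpa using this
  have hne : Polynomial.cyclotomic 5 ℤ ≠ 0 := Polynomial.cyclotomic_ne_zero 5 ℤ
  apply mul_right_cancel₀ hne
  rw [← hx, h5]
  simp only [map_add, map_pow, Polynomial.expand_X, map_one]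
  ring

/-- Reduction of `φ(T) = T + T⁴ − T¹¹ − T¹⁴` modulo `Φ₁₅`: `φ = Φ₁₅·q₁ + r₁`. [folklore] -/
theorem quarticFifteenBiq_phi_reduce :
    ((X + X ^ 4 - X ^ 11 - X ^ 14 : Polynomial ℤ)) =
      (X ^ 8 - X ^ 7 + X ^ 5 - X ^ 4 + X ^ 3 - X + 1) * (1 - X ^ 2 - X ^ 3 - X ^ 4 - X ^ 5 - X ^ 6) + (-1 + 2 * X + X ^ 2 - X ^ 3 + 2 * X ^ 4 + X ^ 7) := by
  ring

/-- `r₁² = Φ₁₅·q₂ + r₂`. [folklore] -/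
theorem quarticFifteenBiq_r1_sq_reduce :
    ((-1 + 2 * X + X ^ 2 - X ^ 3 + 2 * X ^ 4 + X ^ 7) ^ 2 : Polynomial ℤ) =
      (X ^ 8 - X ^ 7 + X ^ 5 - X ^ 4 + X ^ 3 - X + 1) * (7 + 3 * X + 2 * X ^ 2 + 4 * X ^ 3 + X ^ 4 + X ^ 5 + X ^ 6) + (-6 + 3 * X ^ 2 - 3 * X ^ 3 + 3 * X ^ 7) := by
  ring

/-- `r₂² = Φ₁₅·q₄ + r₄`. [folklore] -/
theorem quarticFifteenBiq_r2_sq_reduce :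
    ((-6 + 3 * X ^ 2 - 3 * X ^ 3 + 3 * X ^ 7) ^ 2 : Polynomial ℤ) =
      (X ^ 8 - X ^ 7 + X ^ 5 - X ^ 4 + X ^ 3 - X + 1) * (-9 - 9 * X - 18 * X ^ 2 + 9 * X ^ 4 + 9 * X ^ 5 + 9 * X ^ 6) + (45 - 27 * X ^ 2 + 27 * X ^ 3 - 27 * X ^ 7) := by
  ring

/-- The reduced form of `P(φ)` vanishes identically: `r₄ + 9r₂ + 9 = 0`. [folklore] -/
theorem quarticFifteenBiq_reduced_eq_zero :
    ((45 - 27 * X ^ 2 + 27 * X ^ 3 - 27 * X ^ 7) + 9 * (-6 + 3 * X ^ 2 - 3 * X ^ 3 + 3 * X ^ 7) + 9 : Polynomial ℤ) = 0 := by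
  ring

/-- `Φ₁₅(s) = 0 ⟹ P(s + s⁴ − s¹¹ − s¹⁴) = 0` in any ring, `P = T⁴ + 9T² + 9`. [folklore] -/
theorem eval₂_quarticFifteenBiq_phi {R : Type*} [Ring R] (s : R)
    (hs : Polynomial.eval₂ (Int.castRingHom R) s (Polynomial.cyclotomic 15 ℤ) = 0) :
    Polynomial.eval₂ (Int.castRingHom R) (s + s ^ 4 - s ^ 11 - s ^ 14) (X ^ 4 + 9 * X ^ 2 + 9 : Polynomial ℤ) = 0 := by
  rw [cyclotomic_fifteen_eq, ← algebraMap_int_eq, ← Polynomial.aeval_def] at hs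
  rw [eval₂_quarticFifteenBiq]
  have hy : (s + s ^ 4 - s ^ 11 - s ^ 14 : R) = Polynomial.aeval s ((-1 + 2 * X + X ^ 2 - X ^ 3 + 2 * X ^ 4 + X ^ 7) : Polynomial ℤ) := by
    have : (s + s ^ 4 - s ^ 11 - s ^ 14 : R) = Polynomial.aeval s ((X + X ^ 4 - X ^ 11 - X ^ 14 : Polynomial ℤ)) := by
      simp only [map_add, map_sub, map_pow, Polynomial.aeval_X]
    rw [this, quarticFifteenBiq_phi_reduce, map_add, map_mul, hs, zero_mul, zero_add]
  have hy2 : (s + s ^ 4 - s ^ 11 - s ^ 14 : R) ^ 2 = Polynomial.aeval s ((-6 + 3 * X ^ 2 - 3 * X ^ 3 + 3 * X ^ 7) : Polynomial ℤ) := by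
    rw [hy, ← map_pow, quarticFifteenBiq_r1_sq_reduce, map_add, map_mul, hs, zero_mul, zero_add]
  have hy4 : (s + s ^ 4 - s ^ 11 - s ^ 14 : R) ^ 4 = Polynomial.aeval s ((45 - 27 * X ^ 2 + 27 * X ^ 3 - 27 * X ^ 7) : Polynomial ℤ) := by
    rw [show (4 : ℕ) = 2 * 2 from rfl, pow_mul, hy2, ← map_pow, quarticFifteenBiq_r2_sq_reduce, map_add, map_mul, hs,
      zero_mul, zero_add]
  have h9 : (9 : R) = Polynomial.aeval s (9 : Polynomial ℤ) := (map_ofNat _ _).symm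
  rw [hy2, hy4, h9, ← map_mul, ← map_add, ← map_add, quarticFifteenBiq_reduced_eq_zero, map_zero]

end Quartic

/-! ### §2 R3 for `K′ = ℚ(√-3, √5)` on the `ζ_15`-primitive loci over the Fermat pair `Xʰ_15 ⊗ Xʰ_15` -/

section Placement

/-- **R3 for the biquadratic `K′ = ℚ(√-3, √5) ⊂ ℚ(ζ_15)` on the Fermat-pair-dominated `ζ_15`-locus, from the two named facts.**
For `B` with `s : B ⟶ B`, `Φ_15(s) = 0`, `dim B = 4h`, and a datum over `Xʰ_15 ⊗ Xʰ_15`, every class of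
`weilClassesField B φ (T⁴ + 9T² + 9) (2h)` (`φ = s + s⁴ − s¹¹ − s¹⁴`) with `a^* c` in `⨆ᵢ (bᵢ)^*(span of the rational (h,h)-classes)` that is
rational of type `(h,h)` is algebraic. At `h = 2`: the MOVING non-`E`-Weil family `(1,9,9,11)` of abelian eightfolds (report §3.3).
[cite: Shioda1979PJA, §2 Thm. 2 (p. 112) with the list after Thm. 1] [cite: Fulton1998, §19.2 Cor. 19.2 (b)] [cite: MoonenZarhin1998WeilClasses, §1] -/
theorem weilClassesCMField_cyclicPrymFifteen_biquadratic_of_facts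
    (hF₂ : hodgeClasses_algebraic_fermatProduct₂) (hP : fulton1998_map_mem_algebraicClasses) :
    ∀ (B : Motives.AbelianVariety ℂ) (s : B ⟶ B) (h : ℕ),
      Polynomial.eval₂ (Int.castRingHom (CategoryTheory.End B)) (s : CategoryTheory.End B)
        (Polynomial.cyclotomic 15 ℤ) = 0 → B.dim = 4 * h →
    ∀ (X₁ X₂ T : Motives.SchemeOver ℂ),
      IsFermatVariety h 15 X₁ → IsSmoothProjective h X₁ → IsFermatVariety h 15 X₂ → IsSmoothProjective h X₂ →
      IsSmoothProjective B.dim T →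
    ∀ (a : T ⟶ B.X), AlgebraicGeometry.Surjective a.left → ∀ (ι : Type) (b : ι → (T ⟶ X₁ ⊗ X₂)),
      ∀ c ∈ weilClassesField B (CategoryTheory.End.asHom (CategoryTheory.End.of s + CategoryTheory.End.of s ^ 4 - CategoryTheory.End.of s ^ 11 - CategoryTheory.End.of s ^ 14))
          (X ^ 4 + 9 * X ^ 2 + 9 : Polynomial ℤ) (2 * h),
        complexBetti.map a (2 * h) c ∈ (⨆ i, (Submodule.span ℂ
            {x : complexBetti (X₁ ⊗ X₂) (2 * h) |
              IsRationalClass x ∧ IsOfHodgeType (h + h) (X₁ ⊗ X₂) (2 * h) h h x}).map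
              (complexBetti.map (b i) (2 * h)).hom) →
        IsRationalClass c → IsOfHodgeType B.dim B.X (2 * h) h h c → c ∈ algebraicClasses B.X h := by
  intro B s h _ _ X₁ X₂ T hF₁' hX₁ hF₂' hX₂ hT a ha ι b c _ hc _ _
  exact abelianVariety_mem_algebraicClasses_of_targetTransferFamily hP B (hX₁.tensor_holds hX₂)
    (span_rational_hodge_le_algebraicClasses_fermatProduct₂ hF₂ (Or.inr ⟨by norm_num, by norm_num⟩) hF₁' hX₁ hF₂' hX₂ h)
    hT a b hc

/-- **The same body from the rung R3 itself** — an HONEST SPECIALISATION at `(A, φ, P, e, m) := (B, φ, T⁴ + 9T² + 9, 4, h)`: `P` monic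
irreducible (factor exclusion) of degree `4 > 2`, `P(φ) = 0` from `Φ_15(s) = 0`, `4·(2h) = 2·dim B`, roots non-real, `Q = −T` — every
arithmetic hypothesis DISCHARGED; the datum is not used. -/
theorem weilClassesCMField_cyclicPrymFifteen_biquadratic_of_weilClassesCMField (hR : WeilClassesCMField) :
    ∀ (B : Motives.AbelianVariety ℂ) (s : B ⟶ B) (h : ℕ),
      Polynomial.eval₂ (Int.castRingHom (CategoryTheory.End B)) (s : CategoryTheory.End B)
        (Polynomial.cyclotomic 15 ℤ) = 0 → B.dim = 4 * h →
    ∀ (X₁ X₂ T : Motives.SchemeOver ℂ),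
      IsFermatVariety h 15 X₁ → IsSmoothProjective h X₁ → IsFermatVariety h 15 X₂ → IsSmoothProjective h X₂ →
      IsSmoothProjective B.dim T →
    ∀ (a : T ⟶ B.X), AlgebraicGeometry.Surjective a.left → ∀ (ι : Type) (b : ι → (T ⟶ X₁ ⊗ X₂)),
      ∀ c ∈ weilClassesField B (CategoryTheory.End.asHom (CategoryTheory.End.of s + CategoryTheory.End.of s ^ 4 - CategoryTheory.End.of s ^ 11 - CategoryTheory.End.of s ^ 14))
          (X ^ 4 + 9 * X ^ 2 + 9 : Polynomial ℤ) (2 * h),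
        complexBetti.map a (2 * h) c ∈ (⨆ i, (Submodule.span ℂ
            {x : complexBetti (X₁ ⊗ X₂) (2 * h) |
              IsRationalClass x ∧ IsOfHodgeType (h + h) (X₁ ⊗ X₂) (2 * h) h h x}).map
              (complexBetti.map (b i) (2 * h)).hom) →
        IsRationalClass c → IsOfHodgeType B.dim B.X (2 * h) h h c → c ∈ algebraicClasses B.X h := by
  intro B s h hs hdim _ _ _ _ _ _ _ _ _ _ _ _ c hcW _ hc hmm
  have hφ : Polynomial.eval₂ (Int.castRingHom (CategoryTheory.End B))
      ((CategoryTheory.End.asHom (CategoryTheory.End.of s + CategoryTheory.End.of s ^ 4 - CategoryTheory.End.of s ^ 11 - CategoryTheory.End.of s ^ 14) : B ⟶ B) : CategoryTheory.End B) (X ^ 4 + 9 * X ^ 2 + 9 : Polynomial ℤ) = 0 :=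
    eval₂_quarticFifteenBiq_phi (CategoryTheory.End.of s) hs
  exact hR B _ (X ^ 4 + 9 * X ^ 2 + 9 : Polynomial ℤ) 4 h quarticFifteenBiq_monic
    quarticFifteenBiq_natDegree (by norm_num) quarticFifteenBiq_irreducible hφ (by omega)
    (fun ρ hρ => conj_ne_self_of_quarticFifteenBiq hρ) exists_conjPolynomial_quarticFifteenBiq c hcW hc hmm

/-- **On-path lemma**: `HodgeConjecture → WeilClassesCMField →` R3 for `ℚ(√-3, √5) ⊂ ℚ(ζ_15)` on the `ζ_15`-locus. -/
theorem weilClassesCMField_cyclicPrymFifteen_biquadratic_of_hodgeConjecture (hH : _root_.HodgeConjecture) :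
    ∀ (B : Motives.AbelianVariety ℂ) (s : B ⟶ B) (h : ℕ),
      Polynomial.eval₂ (Int.castRingHom (CategoryTheory.End B)) (s : CategoryTheory.End B)
        (Polynomial.cyclotomic 15 ℤ) = 0 → B.dim = 4 * h →
    ∀ (X₁ X₂ T : Motives.SchemeOver ℂ),
      IsFermatVariety h 15 X₁ → IsSmoothProjective h X₁ → IsFermatVariety h 15 X₂ → IsSmoothProjective h X₂ →
      IsSmoothProjective B.dim T →
    ∀ (a : T ⟶ B.X), AlgebraicGeometry.Surjective a.left → ∀ (ι : Type) (b : ι → (T ⟶ X₁ ⊗ X₂)),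
      ∀ c ∈ weilClassesField B (CategoryTheory.End.asHom (CategoryTheory.End.of s + CategoryTheory.End.of s ^ 4 - CategoryTheory.End.of s ^ 11 - CategoryTheory.End.of s ^ 14))
          (X ^ 4 + 9 * X ^ 2 + 9 : Polynomial ℤ) (2 * h),
        complexBetti.map a (2 * h) c ∈ (⨆ i, (Submodule.span ℂ
            {x : complexBetti (X₁ ⊗ X₂) (2 * h) |
              IsRationalClass x ∧ IsOfHodgeType (h + h) (X₁ ⊗ X₂) (2 * h) h h x}).map
              (complexBetti.map (b i) (2 * h)).hom) →
        IsRationalClass c → IsOfHodgeType B.dim B.X (2 * h) h h c → c ∈ algebraicClasses B.X h :=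
  weilClassesCMField_cyclicPrymFifteen_biquadratic_of_weilClassesCMField (weilClassesCMField_of_hodgeConjecture hH)

end Placement

end Summit.HodgeConjecture.HodgeConjecture.WeilTypeLadder

end
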